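import Summits.AnomalousDissipation.AnomalousDissipation.Theorems.MarginalStabilityChainChainRealisationStubSobolevBootstrapA
import Summits.AnomalousDissipation.AnomalousDissipation.Theorems.MarginalStabilityChainChainRealisationStubH2NonlinearEstimate
import Literature.Analysis.FunctionSpaces.TorusClassicalNSGluing
import HarnessLib

/-!
# Stub `stub_sobolevBootstrap` of the line `SketchIdeator2` (card `separatrix-flux-pinning`)
# (crux `MarginalStabilityChain.ChainRealisation`, stmt-AnomalousDissipation-14249)

Sorry-free discharge of the registered stub `stub_sobolevBootstrap` (B2): the **all-order Sobolev
bootstrap** of a forward classical Navier–Stokes solution `u` on `[0, ∞) × T³` at fixed viscosity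
`ν > 0` with steady smooth force `F`, GIVEN the nonlinear word estimate of the `H^m` energy method (the
neighbouring stub B1, taken verbatim as the antecedent): if the slices are mean-zero, the enstrophy is
bounded on `t ≥ 0` and `‖Δu(t)‖₂²` is bounded on `t ≥ 1`, then `sup_{t ≥ 0} E_k(u(t)) < ∞` for every `k`,
`E_k = sobolevEnergy k` (all ordered derivative words of length `≤ k`; Foias–Manley–Rosa–Temam 2001,
Ch. II App. A §A.4–A.5; Constantin–Foias 1988, Ch. 13).

Paper proof (helper file `…StubSobolevBootstrapA`: the word balance `sobolev_aux_wordBalance` of classical NS and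
its sum `sobolev_aux_hasDerivWithinAt_sobolevEnergy`, the energy identities `E_1 = ‖∇·‖₂²`, `E_2 = ‖Δ·‖₂²`,
`E_3 = ‖∇Δ·‖₂²`, time continuity of the energies, the force bound and the fencing lemma
`sobolev_aux_integral_le_of_deriv_le`).  (a) `t ↦ E_k(u(t))` is continuous on `[0, ∞)`, hence bounded on `[0, 1]`;
in particular `‖Δu(t)‖₂² = E₂-word energy ≤ E_2` is bounded on ALL of `t ≥ 0`.  (b) Induction on `m ≥ 2`
of `P(m)`: `E_m(u(t)) ≤ A` and `∫ₜ^{t+1} E_{m+1}(u) ≤ B` for all `t ≥ 0`.  Base `m = 2`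
(`sobolev_aux_base`): `E_2 = ‖u‖₂² + ‖∇u‖₂² + ‖Δu‖₂² ≤ 28M + M₂` (Poincaré–Wirtinger), and with
`y = ‖Δu‖₂²` the `H²` balance `y' = 2(−ν‖∇Δu‖₂² − ∫⟪(u·∇)u − F, Δ²u⟫)`, the landed `H²` nonlinear
estimate S3 and `2∫⟪F, Δ²u⟫ ≤ ‖ΔF‖₂² + y` give `y' ≤ −ν‖∇Δu‖₂² + K`, whence
`ν ∫ₜ^{t+1} ‖∇Δu‖₂² ≤ y(t) + K` and `E_3 = E_2 + ‖∇Δu‖₂²`.  Step (`sobolev_aux_step`): with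
`y = E_{m+1}(u)`, the word balances summed over `|w| ≤ m + 1`, B1 (with the bound `E_m ≤ A`) and the
force bound give `y' ≤ −ν E_{m+2} + (2ν + 2C + 1) y + (2C + E_{m+1}(F))` from the right on `[0, ∞)`;
the landed uniform Gronwall lemma S2 (`t₀ = 0`, `r = 1`, `∫ₜ^{t+1} y ≤ B`) bounds `y` on `[1, ∞)`,
(a) bounds it on `[0, 1]`, and integrating the inequality bounds `∫ₜ^{t+1} E_{m+2}`.  (c) For `k ≤ 2`,
`E_k ≤ E_2`.
-/

set_option linter.dupNamespace false

noncomputable section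

open MeasureTheory Set Filter Topology
open scoped InnerProductSpace
open Literature.Analysis.FunctionSpaces Literature.Analysis.FunctionSpaces.Torus
open Literature.Analysis.FluidPDE
open Literature.Analysis.FluidPDE.Torus

namespace Summit.AnomalousDissipation.AnomalousDissipation.Theorems.ChainRealisation.SeparatrixFluxPinning

/-! ## The `H²` rung: base of the bootstrap -/

/-- The `H²` balance (`n = 1` case of
`IsClassicalNSSolutionOn.hasDerivWithinAt_half_integral_norm_sq_laplacian_iterate`), doubled and with the
iterates unfolded: within `[a, b]`, `d/dt ‖Δu‖₂² = 2 (−ν ‖∇Δu‖₂² − ∫ ⟪(u·∇)u − F, Δ(Δu)⟫)`. -/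
theorem sobolev_aux_hasDerivWithinAt_integral_norm_sq_laplacian {a b ν : ℝ} {F : UnitAddTorus (Fin 3) → EuclideanSpace ℝ (Fin 3)}
    {u : ℝ → UnitAddTorus (Fin 3) → EuclideanSpace ℝ (Fin 3)} {p : ℝ → UnitAddTorus (Fin 3) → ℝ}
    (h : IsClassicalNSSolutionOn (Icc a b) ν (fun _ => F) u p) (hab : a < b) {t : ℝ}
    (ht : t ∈ Icc a b) :
    HasDerivWithinAt (fun s => ∫ x, ‖laplacian (u s) x‖ ^ 2)
      (2 * (-ν * gradNormSq (laplacian (u t)) -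
        ∫ x, ⟪convect (u t) (u t) x - F x, laplacian (laplacian (u t)) x⟫_ℝ)) (Icc a b) t := by
  have h1 := (h.hasDerivWithinAt_half_integral_norm_sq_laplacian_iterate hab 1 ht).const_mul (2 : ℝ)
  have hfun : (fun s => 2 * (2⁻¹ * ∫ x, ‖(laplacian^[1] (u s)) x‖ ^ 2)) =
      fun s => ∫ x, ‖laplacian (u s) x‖ ^ 2 := by
    funext s
    rw [mul_inv_cancel_left₀ (two_ne_zero : (2 : ℝ) ≠ 0), Function.iterate_one]
  rw [hfun] at h1
  exact h1

/-- The force term of the `H²` balance: `2 ∫ ⟪F, Δ(Δv)⟫ ≤ ‖ΔF‖₂² + ‖Δv‖₂²` (Green's second identity and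
Cauchy–Schwarz). -/
theorem sobolev_aux_two_mul_integral_inner_laplacian_laplacian_le {F v : UnitAddTorus (Fin 3) → EuclideanSpace ℝ (Fin 3)}
    (hF : IsSmooth F) (hv : IsSmooth v) :
    2 * ∫ x, ⟪F x, laplacian (laplacian v) x⟫_ℝ ≤
      (∫ x, ‖laplacian F x‖ ^ 2) + ∫ x, ‖laplacian v x‖ ^ 2 := by
  have hΔF : IsSmooth (laplacian F) := hF.laplacian
  have hΔv : IsSmooth (laplacian v) := hv.laplacian
  rw [← Torus.integral_inner_laplacian_comm hF hΔv]
  have := sobolev_aux_integral_inner_le hΔF hΔv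
  linarith

/-- **Base of the bootstrap (`m = 2`).** For a forward classical solution with mean-zero slices,
`‖∇u(t)‖₂² ≤ M` and `‖Δu(t)‖₂² ≤ M₂` on `t ≥ 0`: `E_2(u(t)) = ‖u‖₂² + ‖∇u‖₂² + ‖Δu‖₂² ≤ 28M + M₂`
(Poincaré–Wirtinger), and the sliding integrals `∫ₜ^{t+1} E_3(u) ≤ B` from the `H²` balance integrated
over `[t, t+1]` (`E_3 − E_2 = ‖∇Δu‖₂²`), the landed `H²` nonlinear estimate S3 and the force bound. -/
theorem sobolev_aux_base {ν M M₂ : ℝ} {F : UnitAddTorus (Fin 3) → EuclideanSpace ℝ (Fin 3)}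
    {u : ℝ → UnitAddTorus (Fin 3) → EuclideanSpace ℝ (Fin 3)} {p : ℝ → UnitAddTorus (Fin 3) → ℝ}
    (hν : 0 < ν) (hF : IsSmooth F) (h : IsClassicalNSSolutionOn (Set.Ici 0) ν (fun _ => F) u p)
    (hzm : ∀ t : ℝ, 0 ≤ t → HasZeroMean (u t)) (hM : ∀ t : ℝ, 0 ≤ t → gradNormSq (u t) ≤ M)
    (hM₂ : ∀ t : ℝ, 0 ≤ t → ∫ x, ‖laplacian (u t) x‖ ^ 2 ≤ M₂) :
    (∃ A : ℝ, ∀ t : ℝ, 0 ≤ t → sobolevEnergy 2 (u t) ≤ A) ∧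
      ∃ B : ℝ, ∀ t : ℝ, 0 ≤ t → ∫ s in t..t + 1, sobolevEnergy 3 (u s) ≤ B := by
  have hU : UniqueDiffOn ℝ (Ici (0 : ℝ)) := uniqueDiffOn_Ici 0
  have hu : Torus.IsSmoothSpaceTimeOn (Ici (0 : ℝ)) u := h.smooth_velocity
  have hM0 : 0 ≤ M := (gradNormSq_nonneg (u 0)).trans (hM 0 le_rfl)
  -- `E_2 = ‖u‖₂² + ‖∇u‖₂² + ‖Δu‖₂² ≤ 27 M + M + M₂`
  have hE2 : ∀ t : ℝ, 0 ≤ t → sobolevEnergy 2 (u t) ≤ 27 * M + M + M₂ := by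
    intro t ht
    have hut : IsSmooth (u t) := hu.isSmooth_slice (mem_Ici.2 ht)
    have e : sobolevEnergy 2 (u t) =
        (∫ x, ‖u t x‖ ^ 2) + gradNormSq (u t) + ∫ x, ‖laplacian (u t) x‖ ^ 2 := by
      simp only [sobolevEnergy, Finset.sum_range_succ, Finset.range_zero, Finset.sum_empty, zero_add,
        wordEnergy_zero, sobolev_aux_wordEnergy_one hut, sobolev_aux_wordEnergy_two hut]
    have hP := integral_norm_sq_le_card_pow_mul_gradNormSq hut (hzm t ht)
    rw [Fintype.card_fin] at hP
    norm_num at hP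
    rw [e]
    have h1 := hM t ht
    have h2 := hM₂ t ht
    nlinarith
  refine ⟨⟨_, hE2⟩, ?_⟩
  -- the `H²` balance gives the sliding integrals of `E_3 − E_2 = ‖∇Δu‖₂²`
  obtain ⟨C₀, hC₀⟩ := stub_h2NonlinearEstimate ν M hν hM0
  obtain ⟨C, hC, hC₀C⟩ : ∃ C : ℝ, 0 ≤ C ∧ C₀ ≤ C := ⟨max C₀ 0, le_max_right _ _, le_max_left _ _⟩
  have hΔst : Torus.IsSmoothSpaceTimeOn (Ici (0 : ℝ)) (fun s => laplacian (u s)) := hu.laplacian hU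
  have hL2 : Torus.IsSmoothSpaceTimeOn (Ici (0 : ℝ)) (fun s x => ‖laplacian (u s) x‖ ^ 2) :=
    ContDiffOn.norm_sq ℝ hΔst
  have hYc : ContinuousOn (fun s => ∫ x, ‖laplacian (u s) x‖ ^ 2) (Ici (0 : ℝ)) :=
    hL2.continuousOn_integral (convex_Ici 0)
  have hGc : ContinuousOn (fun s => wordEnergy 3 (u s)) (Ici (0 : ℝ)) := sobolev_aux_continuousOn_wordEnergy hu 3
  have hYd : ∀ s : ℝ, 0 ≤ s → HasDerivWithinAt (fun r => ∫ x, ‖laplacian (u r) x‖ ^ 2)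
      (2 * (-ν * gradNormSq (laplacian (u s)) -
        ∫ x, ⟪convect (u s) (u s) x - F x, laplacian (laplacian (u s)) x⟫_ℝ)) (Ici s) s := by
    intro s hs
    have hs1 : (0 : ℝ) < s + 1 := by linarith
    have hS : Icc 0 (s + 1) ⊆ Ici (0 : ℝ) := fun r hr => mem_Ici.2 hr.1
    exact (sobolev_aux_hasDerivWithinAt_integral_norm_sq_laplacian (h.mono hS (uniqueDiffOn_Icc hs1)) hs1
      ⟨hs, (lt_add_one s).le⟩).mono_of_mem_nhdsWithin (Icc_mem_nhdsGE_of_mem ⟨hs, lt_add_one s⟩)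
  have hineq : ∀ s : ℝ, 0 ≤ s →
      2 * (-ν * gradNormSq (laplacian (u s)) -
        ∫ x, ⟪convect (u s) (u s) x - F x, laplacian (laplacian (u s)) x⟫_ℝ) ≤
      -ν * wordEnergy 3 (u s) + (2 * C * (1 + M₂) ^ 2 + (∫ x, ‖laplacian F x‖ ^ 2) + M₂) := by
    intro s hs
    have hs0 : s ∈ Ici (0 : ℝ) := mem_Ici.2 hs
    have hus : IsSmooth (u s) := hu.isSmooth_slice hs0
    have hΔΔ : IsSmooth (laplacian (laplacian (u s))) := hus.laplacian.laplacian
    have hconv : IsSmooth (convect (u s) (u s)) := hus.convect hus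
    have hsplit : (∫ x, ⟪convect (u s) (u s) x - F x, laplacian (laplacian (u s)) x⟫_ℝ) =
        (∫ x, ⟪convect (u s) (u s) x, laplacian (laplacian (u s)) x⟫_ℝ) -
          ∫ x, ⟪F x, laplacian (laplacian (u s)) x⟫_ℝ := by
      simp only [inner_sub_left]
      exact integral_sub (hconv.inner hΔΔ).integrable (hF.inner hΔΔ).integrable
    have hN := (neg_le_abs _).trans (hC₀ (u s) hus (h.divFree s hs0) (hzm s hs) (hM s hs))
    have hY0 : 0 ≤ ∫ x, ‖laplacian (u s) x‖ ^ 2 := integral_nonneg fun _ => sq_nonneg _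
    have hYM := hM₂ s hs
    have hCC : C₀ * (1 + ∫ x, ‖laplacian (u s) x‖ ^ 2) ^ 2 ≤ C * (1 + M₂) ^ 2 := by
      have h1 : C₀ * (1 + ∫ x, ‖laplacian (u s) x‖ ^ 2) ^ 2 ≤ C * (1 + ∫ x, ‖laplacian (u s) x‖ ^ 2) ^ 2 :=
        mul_le_mul_of_nonneg_right hC₀C (sq_nonneg _)
      have h2 : (1 + ∫ x, ‖laplacian (u s) x‖ ^ 2) ^ 2 ≤ (1 + M₂) ^ 2 :=
        pow_le_pow_left₀ (by linarith) (by linarith) 2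
      nlinarith
    have hP := sobolev_aux_two_mul_integral_inner_laplacian_laplacian_le hF hus
    rw [hsplit, sobolev_aux_wordEnergy_three hus]
    linarith
  have hY0 : ∀ s : ℝ, 0 ≤ s → 0 ≤ ∫ x, ‖laplacian (u s) x‖ ^ 2 := fun _ _ =>
    integral_nonneg fun _ => sq_nonneg _
  have hW3 : ∀ t : ℝ, 0 ≤ t → ν * ∫ s in t..t + 1, wordEnergy 3 (u s) ≤
      M₂ + (2 * C * (1 + M₂) ^ 2 + (∫ x, ‖laplacian F x‖ ^ 2) + M₂) := fun t ht =>
    (sobolev_aux_integral_le_of_deriv_le hYc hGc hYd hineq hY0 ht).trans (add_le_add (hM₂ t ht) le_rfl)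
  refine ⟨(27 * M + M + M₂) + (M₂ + (2 * C * (1 + M₂) ^ 2 + (∫ x, ‖laplacian F x‖ ^ 2) + M₂)) / ν,
    fun t ht => ?_⟩
  have ht1 : t ≤ t + 1 := (lt_add_one t).le
  have hi3 : IntervalIntegrable (fun s => sobolevEnergy 3 (u s)) volume t (t + 1) :=
    uniformGronwall_intervalIntegrable (sobolev_aux_continuousOn_sobolevEnergy hu 3) ht ht1
  have hiW : IntervalIntegrable (fun s => wordEnergy 3 (u s)) volume t (t + 1) :=
    uniformGronwall_intervalIntegrable hGc ht ht1
  have hmono : ∫ s in t..t + 1, sobolevEnergy 3 (u s) ≤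
      ∫ s in t..t + 1, ((27 * M + M + M₂) + wordEnergy 3 (u s)) :=
    intervalIntegral.integral_mono_on ht1 hi3 (intervalIntegrable_const.add hiW) fun s hs => by
      rw [show sobolevEnergy 3 (u s) = sobolevEnergy 2 (u s) + wordEnergy 3 (u s) from
        Finset.sum_range_succ _ _]
      exact add_le_add (hE2 s (ht.trans hs.1)) le_rfl
  rw [intervalIntegral.integral_add intervalIntegrable_const hiW, intervalIntegral.integral_const,
    add_sub_cancel_left, one_smul] at hmono
  have h3 : ∫ s in t..t + 1, wordEnergy 3 (u s) ≤
      (M₂ + (2 * C * (1 + M₂) ^ 2 + (∫ x, ‖laplacian F x‖ ^ 2) + M₂)) / ν := by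
    rw [le_div_iff₀ hν, mul_comm]
    exact hW3 t ht
  linarith

/-! ## The induction step and the stub -/

/-- **Step of the bootstrap (`m ⇒ m + 1`, `m ≥ 2`)**, given the nonlinear word estimate (B1).  With
`y = E_{m+1}(u(·))`, the `H^{m+1}` balance summed over all words of length `≤ m + 1`, (B1) (instantiated
with the bound `E_m ≤ A`) and the force bound give, from the right at every `s ≥ 0`,
`y' ≤ −ν E_{m+2} + (2ν + 2C + 1) y + (2C + E_{m+1}(F))`; the uniform Gronwall lemma S2 (`t₀ = 0`,
`r = 1`, sliding integrals `∫ₜ^{t+1} y ≤ B`) bounds `y` on `[1, ∞)`, continuity bounds it on `[0, 1]`, and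
integrating the inequality over `[t, t+1]` bounds `∫ₜ^{t+1} E_{m+2}`. -/
theorem sobolev_aux_step
    (hant : ∀ (ν : ℝ) (m : ℕ) (A : ℝ), 0 < ν → 2 ≤ m → ∃ C : ℝ, ∀ u : UnitAddTorus (Fin 3) → EuclideanSpace ℝ (Fin 3),
      IsSmooth u → IsDivFree u →
      sobolevEnergy m u ≤ A →
      |∑ n ∈ Finset.range (m + 2), ∑ v : Fin n → Fin 3,
          ∫ x, ⟪wordDeriv (List.ofFn v) (convect u u) x, wordDeriv (List.ofFn v) u x⟫_ℝ| ≤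
        ν / 2 * sobolevEnergy (m + 2) u + C * (1 + sobolevEnergy (m + 1) u))
    {ν : ℝ} {F : UnitAddTorus (Fin 3) → EuclideanSpace ℝ (Fin 3)} {u : ℝ → UnitAddTorus (Fin 3) → EuclideanSpace ℝ (Fin 3)}
    {p : ℝ → UnitAddTorus (Fin 3) → ℝ}
    (hν : 0 < ν) (hF : IsSmooth F) (h : IsClassicalNSSolutionOn (Set.Ici 0) ν (fun _ => F) u p)
    {m : ℕ} (hm : 2 ≤ m) {A B : ℝ}
    (hA : ∀ t : ℝ, 0 ≤ t → sobolevEnergy m (u t) ≤ A)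
    (hB : ∀ t : ℝ, 0 ≤ t → ∫ s in t..t + 1, sobolevEnergy (m + 1) (u s) ≤ B) :
    (∃ A' : ℝ, ∀ t : ℝ, 0 ≤ t → sobolevEnergy (m + 1) (u t) ≤ A') ∧
      ∃ B' : ℝ, ∀ t : ℝ, 0 ≤ t → ∫ s in t..t + 1, sobolevEnergy (m + 2) (u s) ≤ B' := by
  have hu : Torus.IsSmoothSpaceTimeOn (Ici (0 : ℝ)) u := h.smooth_velocity
  obtain ⟨C₀, hC₀⟩ := hant ν m A hν hm
  obtain ⟨C, hC, hC₀C⟩ : ∃ C : ℝ, 0 ≤ C ∧ C₀ ≤ C := ⟨max C₀ 0, le_max_right _ _, le_max_left _ _⟩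
  have hEF : 0 ≤ sobolevEnergy (m + 1) F := sobolevEnergy_nonneg _ _
  have hg0 : 0 ≤ 2 * ν + 2 * C + 1 := by positivity
  have hh0 : 0 ≤ 2 * C + sobolevEnergy (m + 1) F := by positivity
  -- continuity of `y = E_{m+1}(u)` and of `E_{m+2}(u)`
  have hYc : ContinuousOn (fun s => sobolevEnergy (m + 1) (u s)) (Ici (0 : ℝ)) :=
    sobolev_aux_continuousOn_sobolevEnergy hu (m + 1)
  have hGc : ContinuousOn (fun s => sobolevEnergy (m + 2) (u s)) (Ici (0 : ℝ)) :=
    sobolev_aux_continuousOn_sobolevEnergy hu (m + 2)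
  have hY0 : ∀ s : ℝ, 0 ≤ s → 0 ≤ sobolevEnergy (m + 1) (u s) := fun s _ => sobolevEnergy_nonneg _ _
  -- the `H^{m+1}` balance, doubled, as a right derivative at every `s ≥ 0`
  have hYd : ∀ s : ℝ, 0 ≤ s → HasDerivWithinAt (fun r => sobolevEnergy (m + 1) (u r))
      (2 * ∑ n ∈ Finset.range (m + 2), ∑ v : Fin n → Fin 3,
        (-ν * gradNormSq (wordDeriv (List.ofFn v) (u s)) -
          (∫ x, ⟪wordDeriv (List.ofFn v) (convect (u s) (u s)) x, wordDeriv (List.ofFn v) (u s) x⟫_ℝ) +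
          ∫ x, ⟪wordDeriv (List.ofFn v) F x, wordDeriv (List.ofFn v) (u s) x⟫_ℝ)) (Ici s) s := by
    intro s hs
    have hs1 : (0 : ℝ) < s + 1 := by linarith
    have hS : Icc 0 (s + 1) ⊆ Ici (0 : ℝ) := fun r hr => mem_Ici.2 hr.1
    have h1 := ((sobolev_aux_hasDerivWithinAt_sobolevEnergy (h.mono hS (uniqueDiffOn_Icc hs1)) hs1 (m + 1)
      ⟨hs, (lt_add_one s).le⟩).const_mul (2 : ℝ)).mono_of_mem_nhdsWithin
      (Icc_mem_nhdsGE_of_mem ⟨hs, lt_add_one s⟩)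
    have hfun : (fun r => 2 * (2⁻¹ * sobolevEnergy (m + 1) (u r))) = fun r => sobolevEnergy (m + 1) (u r) := by
      funext r
      ring
    rw [hfun] at h1
    exact h1
  -- the differential inequality `y' ≤ −ν E_{m+2} + g y + h`
  have hineq : ∀ s : ℝ, 0 ≤ s →
      2 * ∑ n ∈ Finset.range (m + 2), ∑ v : Fin n → Fin 3,
        (-ν * gradNormSq (wordDeriv (List.ofFn v) (u s)) -
          (∫ x, ⟪wordDeriv (List.ofFn v) (convect (u s) (u s)) x, wordDeriv (List.ofFn v) (u s) x⟫_ℝ) +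
          ∫ x, ⟪wordDeriv (List.ofFn v) F x, wordDeriv (List.ofFn v) (u s) x⟫_ℝ) ≤
      -ν * sobolevEnergy (m + 2) (u s) +
        ((2 * ν + 2 * C + 1) * sobolevEnergy (m + 1) (u s) + (2 * C + sobolevEnergy (m + 1) F)) := by
    intro s hs
    have hs0 : s ∈ Ici (0 : ℝ) := mem_Ici.2 hs
    have hus : IsSmooth (u s) := hu.isSmooth_slice hs0
    have hN := (neg_le_abs _).trans (hC₀ (u s) hus (h.divFree s hs0) (hA s hs))
    have hΦ : ∑ n ∈ Finset.range (m + 2), ∑ v : Fin n → Fin 3,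
        ∫ x, ⟪wordDeriv (List.ofFn v) F x, wordDeriv (List.ofFn v) (u s) x⟫_ℝ ≤
        2⁻¹ * (sobolevEnergy (m + 1) F + sobolevEnergy (m + 1) (u s)) :=
      sobolev_aux_sum_integral_inner_wordDeriv_le (m + 1) hF hus
    have hD : ∑ n ∈ Finset.range (m + 2), ∑ v : Fin n → Fin 3, gradNormSq (wordDeriv (List.ofFn v) (u s)) +
        ∫ x, ‖u s x‖ ^ 2 = sobolevEnergy (m + 2) (u s) :=
      sobolev_aux_sum_gradNormSq_wordDeriv (m + 1) hus
    have hW0 : ∫ x, ‖u s x‖ ^ 2 ≤ sobolevEnergy (m + 1) (u s) := by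
      have := wordEnergy_le_sobolevEnergy (Nat.zero_le (m + 1)) (u s)
      rwa [wordEnergy_zero] at this
    have hW0' : ν * ∫ x, ‖u s x‖ ^ 2 ≤ ν * sobolevEnergy (m + 1) (u s) := mul_le_mul_of_nonneg_left hW0 hν.le
    have hCC : C₀ * (1 + sobolevEnergy (m + 1) (u s)) ≤ C * (1 + sobolevEnergy (m + 1) (u s)) :=
      mul_le_mul_of_nonneg_right hC₀C (by linarith [hY0 s hs])
    have hD' : ν * ∑ n ∈ Finset.range (m + 2), ∑ v : Fin n → Fin 3, gradNormSq (wordDeriv (List.ofFn v) (u s)) =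
        ν * sobolevEnergy (m + 2) (u s) - ν * ∫ x, ‖u s x‖ ^ 2 := by
      rw [← hD]
      ring
    simp only [Finset.sum_add_distrib, Finset.sum_sub_distrib, ← Finset.mul_sum]
    linarith
  -- (i) `E_{m+1}` bounded on `[1, ∞)` by the uniform Gronwall lemma, on `[0, 1]` by continuity
  have hGron := stub_uniformGronwall (fun s => sobolevEnergy (m + 1) (u s))
    (fun s => 2 * ∑ n ∈ Finset.range (m + 2), ∑ v : Fin n → Fin 3,
        (-ν * gradNormSq (wordDeriv (List.ofFn v) (u s)) -
          (∫ x, ⟪wordDeriv (List.ofFn v) (convect (u s) (u s)) x, wordDeriv (List.ofFn v) (u s) x⟫_ℝ) +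
          ∫ x, ⟪wordDeriv (List.ofFn v) F x, wordDeriv (List.ofFn v) (u s) x⟫_ℝ))
    (fun _ => 2 * ν + 2 * C + 1) (fun _ => 2 * C + sobolevEnergy (m + 1) F) 0 1
    (2 * ν + 2 * C + 1) (2 * C + sobolevEnergy (m + 1) F) B one_pos hYc continuousOn_const continuousOn_const
    hYd (fun s hs => (hineq s hs).trans (by nlinarith [sobolevEnergy_nonneg (m + 2) (u s), hν]))
    hY0 (fun _ _ => hg0) (fun _ _ => hh0)
    (fun t _ => by rw [intervalIntegral.integral_const, add_sub_cancel_left, one_smul])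
    (fun t _ => by rw [intervalIntegral.integral_const, add_sub_cancel_left, one_smul]) hB
  obtain ⟨C₁, hC₁⟩ := sobolev_aux_exists_bound_Icc hu (m + 1) 1
  set A' : ℝ := max C₁ ((B / 1 + (2 * C + sobolevEnergy (m + 1) F)) * Real.exp (2 * ν + 2 * C + 1)) with hA'
  have hA'b : ∀ t : ℝ, 0 ≤ t → sobolevEnergy (m + 1) (u t) ≤ A' := by
    intro t ht
    rcases le_or_gt t 1 with h1 | h1
    · exact (hC₁ t ⟨ht, h1⟩).trans (le_max_left _ _)
    · have key := hGron (t - 1) (by linarith)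
      rw [sub_add_cancel] at key
      exact key.trans (le_max_right _ _)
  refine ⟨⟨A', hA'b⟩, ?_⟩
  -- (ii) sliding integrals of `E_{m+2}` by integrating the inequality
  have hineq' : ∀ s : ℝ, 0 ≤ s →
      2 * ∑ n ∈ Finset.range (m + 2), ∑ v : Fin n → Fin 3,
        (-ν * gradNormSq (wordDeriv (List.ofFn v) (u s)) -
          (∫ x, ⟪wordDeriv (List.ofFn v) (convect (u s) (u s)) x, wordDeriv (List.ofFn v) (u s) x⟫_ℝ) +
          ∫ x, ⟪wordDeriv (List.ofFn v) F x, wordDeriv (List.ofFn v) (u s) x⟫_ℝ) ≤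
      -ν * sobolevEnergy (m + 2) (u s) +
        ((2 * ν + 2 * C + 1) * A' + (2 * C + sobolevEnergy (m + 1) F)) := fun s hs =>
    (hineq s hs).trans (by nlinarith [hA'b s hs, hg0])
  refine ⟨(A' + ((2 * ν + 2 * C + 1) * A' + (2 * C + sobolevEnergy (m + 1) F))) / ν, fun t ht => ?_⟩
  rw [le_div_iff₀ hν, mul_comm]
  exact (sobolev_aux_integral_le_of_deriv_le hYc hGc hYd hineq' hY0 ht).trans
    (add_le_add (hA'b t ht) le_rfl)

/-- Stub B2 (L) **the all-order Sobolev bootstrap** (given B1): a forward classical solution with mean-zero slices,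
`‖∇u(t)‖₂² ≤ M` on `t ≥ 0` and `‖Δu(t)‖₂² ≤ M₂` on `t ≥ 1` has `sup_{t ≥ 0} E_k(u(t)) < ∞` for every `k`.  On compact
time intervals by continuity of `t ↦ E_k(u(t))`; `‖Δu(t)‖₂²` is thus bounded on all of `t ≥ 0`, and by induction on
`m ≥ 2` with hypothesis `sup_{t ≥ 0} E_m ≤ A ∧ sup_t ∫ₜ^{t+1} E_{m+1} ≤ B`: the WORD BALANCE of classical NS
(`d/dt ½∫‖∂^w u‖² = −ν‖∇∂^w u‖₂² − ∫⟪∂^w((u·∇)u), ∂^w u⟫ + ∫⟪∂^w F, ∂^w u⟫`, the pressure drops since `∂^w u` is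
solenoidal) summed over `|w| ≤ m + 1` gives `E_{m+1}' ≤ −ν E_{m+2} + g E_{m+1} + h` by B1, so the landed uniform
Gronwall lemma bounds `E_{m+1}` and integration bounds `∫ₜ^{t+1}E_{m+2}`; base `m = 2`: `E_2 ≤ 28M + M₂` (Poincaré,
`∑ᵢⱼ‖∂ᵢ∂ⱼu‖² = ‖Δu‖²`) and `∫ₜ^{t+1} E_3 ≤ B` from the `H²` balance with the landed `stub_h2NonlinearEstimate`
(`E_3 − E_2 = ‖∇Δu‖₂²`).  (FMRT 2001 Ch. II §A.4–A.5; Constantin–Foias 1988 Ch. 13.) -/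
theorem stub_sobolevBootstrap :
    (∀ (ν : ℝ) (m : ℕ) (A : ℝ), 0 < ν → 2 ≤ m → ∃ C : ℝ, ∀ u : UnitAddTorus (Fin 3) → EuclideanSpace ℝ (Fin 3),
      IsSmooth u → IsDivFree u → sobolevEnergy m u ≤ A →
      |∑ n ∈ Finset.range (m + 2), ∑ v : Fin n → Fin 3,
          ∫ x, ⟪wordDeriv (List.ofFn v) (convect u u) x, wordDeriv (List.ofFn v) u x⟫_ℝ| ≤
        ν / 2 * sobolevEnergy (m + 2) u + C * (1 + sobolevEnergy (m + 1) u)) →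
    ∀ (ν : ℝ) (F : UnitAddTorus (Fin 3) → EuclideanSpace ℝ (Fin 3)) (u : ℝ → UnitAddTorus (Fin 3) → EuclideanSpace ℝ (Fin 3))
      (p : ℝ → UnitAddTorus (Fin 3) → ℝ),
      0 < ν → IsSmooth F → IsClassicalNSSolutionOn (Set.Ici 0) ν (fun _ => F) u p →
      (∀ t : ℝ, 0 ≤ t → HasZeroMean (u t)) →
      (∃ M : ℝ, ∀ t : ℝ, 0 ≤ t → gradNormSq (u t) ≤ M) →
      (∃ M₂ : ℝ, ∀ t : ℝ, 1 ≤ t → ∫ x, ‖laplacian (u t) x‖ ^ 2 ≤ M₂) →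
      ∀ k : ℕ, ∃ C : ℝ, ∀ t : ℝ, 0 ≤ t → sobolevEnergy k (u t) ≤ C := by
  intro hant ν F u p hν hF h hzm hM hM2
  obtain ⟨M, hM⟩ := hM
  obtain ⟨M₂, hM2⟩ := hM2
  have hu : Torus.IsSmoothSpaceTimeOn (Ici (0 : ℝ)) u := h.smooth_velocity
  -- `‖Δu(t)‖₂²` is bounded on all of `t ≥ 0` (continuity on `[0, 1]`)
  obtain ⟨M₂', hM2'⟩ : ∃ M₂' : ℝ, ∀ t : ℝ, 0 ≤ t → ∫ x, ‖laplacian (u t) x‖ ^ 2 ≤ M₂' := by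
    obtain ⟨C, hC⟩ := sobolev_aux_exists_bound_Icc hu 2 1
    refine ⟨max C M₂, fun t ht => ?_⟩
    rcases le_or_gt t 1 with h1 | h1
    · have hut : IsSmooth (u t) := hu.isSmooth_slice (mem_Ici.2 ht)
      rw [← sobolev_aux_wordEnergy_two hut]
      exact ((wordEnergy_le_sobolevEnergy le_rfl _).trans (hC t ⟨ht, h1⟩)).trans (le_max_left _ _)
    · exact (hM2 t h1.le).trans (le_max_right _ _)
  -- induction on `m ≥ 2`
  have key : ∀ m : ℕ, 2 ≤ m → (∃ A : ℝ, ∀ t : ℝ, 0 ≤ t → sobolevEnergy m (u t) ≤ A) ∧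
      ∃ B : ℝ, ∀ t : ℝ, 0 ≤ t → ∫ s in t..t + 1, sobolevEnergy (m + 1) (u s) ≤ B := by
    intro m hm
    induction m, hm using Nat.le_induction with
    | base => exact sobolev_aux_base hν hF h hzm hM hM2'
    | succ n hn ih =>
      obtain ⟨⟨A, hA⟩, B, hB⟩ := ih
      exact sobolev_aux_step hant hν hF h hn hA hB
  intro k
  rcases le_or_gt 2 k with hk | hk
  · exact (key k hk).1
  · obtain ⟨A, hA⟩ := (key 2 le_rfl).1
    exact ⟨A, fun t ht => (sobolevEnergy_mono hk.le _).trans (hA t ht)⟩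

end Summit.AnomalousDissipation.AnomalousDissipation.Theorems.ChainRealisation.SeparatrixFluxPinning

end
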